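import Summits.BirchSwinnertonDyer.Rank1Residual.ManinAdditive.ALFixedPointDiscriminantLaw
import Literature.NumberTheory.EllipticCurves.Sha
import Mathlib.NumberTheory.Padics.PadicNumbers
import HarnessLib
import HarnessLib.Audit.Tags

/-!
# es g36 (cell bsd-f2-manin, MEMO-es §57.12) — the torsion-CM invariant `t` in the residual class of THEOREM L♮:
# the EVEN-RANK 2-SELMER DEGREE LAW at `N = 4p`

Habitat (the class where hypothesis (iii) of L♮ / E-es-173 FAILS on the tame cell with `ω(N) = 2`): `N = 4p`, `p ≡ 3 (mod 4)`
prime, `E(ℚ)[2] = 0`, `ℚ(√Δ_E) = ℚ(√−p)`.  There the sign-`−1` Atkin–Lehner-fixed CM points map to torsion points `Q + t`,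
`t ∈ E[2]` constant on Galois orbits, and `deg φ♭ ≡ [t ≠ 0] (mod 2)` (MEMO-es §57.12.1; `h(−p)` odd).  DATA LAW found by the
census (MEMO-es §57.12.2, engine census14.py): for EVEN analytic rank (`w_N f = −f`)

  `v₂(deg φ) = 1  ⟺  rank E(ℚ) = 0 ∧ Ш(E/ℚ)[2] = 0  (⟺ Sel₂(E/ℚ) = 0)`  — 633 / 633 curves with `4p < 5·10⁵`
  (rank 0, `Ш_an` odd: 371, all `v₂(deg φ) = 1`; rank 0, `Ш_an` even: 41, all `v₂ ≥ 2`; rank 2: 221, all `v₂ ≥ 2`; Kodaira IV and IV* alike),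

read: «the torsion CM value mod `E[2]` is non-zero iff the 2-Selmer group vanishes» — a `p = 2`, torsion-CM analogue of
Kolyvagin's conjecture / W. Zhang's theorem (`c(1) ≠ 0 mod p ⟺ Sel_p minimal`).  Typed as two rows: the direction valid for ANY
parametrisation datum at the conductor (E-es-174a) and the converse for LATTICE-OPTIMAL data (E-es-174b; `v₂(deg)` is not
invariant under `φ ↦ [n]∘φ`).  Census caveat: `Ш[2] = 0` is read from `Ш_an` (BSD-exact in Cremona's table), rank = algebraic rank.
ODD rank (`w_N f = f`) is NOT covered: there `t ≠ 0 ⟺ P ∉ 2E(ℚ₂) ⟺ P ∉ 2E(ℚ_p)` for `p ≡ 7 (mod 8)` (195/195, MEMO-es §57.12.3,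
not typed: needs a generator) and the class `p ≡ 3 (mod 8)`, Kodaira IV is unresolved (117 : 60).
PARTITION 0 · BSD is not proved by this; Manin's conjecture is not proved by this (degree laws, no Manin implication).

TYPER NOTE (typer g21, T-es-69 = Sketch-d «+= Sketch-e», ONE file per D-0064).  SOURCES = HOME/es/g36/Sketch-es-g36d.lean sha16 1d3f041278479550
(84 l.; es: rc 0, BC7 2/2 CLEAN Probe-es-g36e.lean b19c03c3169fe4b3; MEMO-es §57.12, HOME/es/g36/MEMO-es-sec57-12.md; census14.py, 633/633) and
HOME/es/g36/Sketch-es-g36e.lean sha16 da45e236a9c9e2fb (70 l.; es: rc 0, BC7 2/2 CLEAN Probe-es-g36f.lean 443cd748932e6855; MEMO-es §57.12.8;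
census19.py e7f7f94b63185c15 → out-census19-500000.txt 429ae6fff5ac9636, 198/198), BOTH VERBATIM and concatenated in that order (this module
docstring = Sketch-d's header + this note; Sketch-e's header follows below as a section comment; Sketch-e's import lines merged into the header:
landed `…ManinAdditive.ALFixedPointDiscriminantLaw` (p749369) + Literature `Sha` + `Mathlib.NumberTheory.Padics.PadicNumbers` + HarnessLib(+Audit.Tags));
namespace `…ManinAdditive.AtkinLehnerDegree` (es's, = the landed L♮ files').  DEFINITIONS (real): `ShaTwoTrivial` (Ш(W)[2] = 0 on the tree's
`WeierstrassCurve.sha`; NB the same one-liner exists as `…F1Sign2…ShaTwoTrivial` in `Rank1Residual/F1Sign2/DescentSignAtTwo.lean` and, in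
`Nat.card` form, in a `Cruxes/RankOneAtTwoOffBigImageOddLocal` line file — NOT imported here on purpose: pulling the 2-descent-sign cone of another
topic folder into ManinAdditive for one line is worse than a local restatement; distinct FQNs), `RamifiedKummerClassAtTwo`.  ROWS (es's
`@[conjecture]` tags, nothing asserted): **E-es-174a `EvenRankDegreeTwoModFourForcesSelmerTrivial`**, **E-es-174b `EvenRankSelmerTrivialForcesDegreeTwoModFour`**,
**E-es-176a `OddRankIVRamifiedKummerOfDegreeTwoModFour`**, **E-es-176b `OddRankIVDegreeTwoModFourOfRamifiedKummer`**; PROVED edge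
`four_dvd_modularDegree_of_evenRank_selmer_nontrivial`.  FACT M1 («AL cusp values are ℚ-rational», Manin 1972 / Cremona §2.8) is a separate
Literature item — see the typer's bus line.  REFUTER: ref1/ref2 R-es-85 PENDING at landing.  7 decl names fresh in this namespace; cite key Watkins2002
present; no instances, no notation, no sorry.  `--supports` refused for ManinAdditive ⇒ bears_on: stmt-BirchSwinnertonDyer-22967 (C2 `ManinOddAtFour`).
BSD is not proved by this; C2 OPEN.
-/

namespace Summit.BirchSwinnertonDyer.Rank1Residual.ManinAdditive.AtkinLehnerDegree

open scoped MatrixGroups ModularForm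
open CongruenceSubgroup WeierstrassCurve
open Literature.NumberTheory.EllipticCurves Literature.NumberTheory.EllipticCurves.ModularForms
open Summit.BirchSwinnertonDyer.Rank1Residual.ManinAdditive.ConwayCut

/-- `Ш(W/ℚ)[2] = 0` for a Weierstrass curve over `ℚ` (the tree's `WeierstrassCurve.sha`, Literature `EllipticCurves/Sha`). -/
def ShaTwoTrivial (W : WeierstrassCurve ℚ) : Prop :=
  ∀ x ∈ W.sha, (2 : ℕ) • x = 0 → x = 0

/-- **Row E-es-174a `EvenRankDegreeTwoModFourForcesSelmerTrivial`** (LAW, NEW; MEMO-es §57.12.2): `N = 4p`, `p ≡ 3 (mod 4)`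
prime, no rational 2-torsion, `ℚ(√Δ_E) = ℚ(√−p)` (`−p·Δ` a square), Fricke sign `−1` (`w_N f = −f`, even analytic rank); then
for ANY parametrisation datum at the conductor: `v₂(deg φ) = 1 ⟹ rank E(ℚ) = 0 ∧ Ш(E/ℚ)[2] = 0`.
Census: 633 / 633 (`v₂(deg φ) = 1` occurs 371 times, each with rank 0 and `Ш_an` odd; never at rank 2 (221) or `Ш_an` even (41)).
Why it might fail: a rank-0 curve in the class with `Ш[2] ≠ 0` and `deg φ ≡ 2 (mod 4)`, or a rank-2 one (refined Watkins would also fail).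
[cite: Watkins2002, Conj. 4.2 (arXiv:math/0109101 p. 12: 2^rank ∣ deg φ — the rank-2 third of this row; the Ш[2] two-thirds is the cell's E-es-174, NOT in print)] -/
@[conjecture]
def EvenRankDegreeTwoModFourForcesSelmerTrivial : Prop :=
  ∀ (W : WeierstrassCurve ℚ) [W.IsElliptic] [W.IsGloballyMinimal] {N : ℕ} [NeZero N]
    (D : ModularParametrizationData W N) (p : ℕ), p.Prime → p % 4 = 3 → N = 4 * p → W.conductorNorm ℤ = N →
    ¬ HasRationalTwoTorsion W → IsSquare (-(p : ℚ) * W.Δ) → frickeInvolution N 2 D.f = -D.f →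
    padicValNat 2 D.modularDegree = 1 → W.mordellWeilRank = 0 ∧ ShaTwoTrivial W

/-- **Row E-es-174b `EvenRankSelmerTrivialForcesDegreeTwoModFour`** (LAW, NEW; MEMO-es §57.12.2), the converse for
LATTICE-OPTIMAL data (`Λ_W = c·Λ_f`, the hypothesis of C2 `ManinOddAtFour`): same habitat; `rank E(ℚ) = 0 ∧ Ш(E/ℚ)[2] = 0 ⟹
¬ 4 ∣ deg φ` (with the parity floor: `deg φ ≡ 2 (mod 4)`).  Census: 371 / 371 (every rank-0 curve of the class with `Ш_an` odd has
`v₂(deg φ) = 1`).  Why it might fail: a rank-0, `Ш[2] = 0` member whose `w_N`-fixed CM points of discriminant `−4p`/`−p` all map to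
the rational half-point (`t = 0`); none below `5·10⁵`.
[cite: Watkins2002, §4 (arXiv:math/0109101 p. 12: heuristics for powers of 2 in deg φ; this converse law is the cell's E-es-174b, NOT in print)] -/
@[conjecture]
def EvenRankSelmerTrivialForcesDegreeTwoModFour : Prop :=
  ∀ (W : WeierstrassCurve ℚ) [W.IsElliptic] [W.IsGloballyMinimal] {N : ℕ} [NeZero N]
    (D : ModularParametrizationData W N) (p : ℕ), p.Prime → p % 4 = 3 → N = 4 * p → W.conductorNorm ℤ = N →
    (∀ z ∈ D.L.lattice, ∃ w ∈ periodLattice D.f, z = D.c * w) →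
    ¬ HasRationalTwoTorsion W → IsSquare (-(p : ℚ) * W.Δ) → frickeInvolution N 2 D.f = -D.f →
    W.mordellWeilRank = 0 → ShaTwoTrivial W → ¬ 2 ^ 2 ∣ D.modularDegree

/-- Edge: under E-es-174a, in the habitat, `4 ∣ deg φ` as soon as the rank is positive OR `Ш[2] ≠ 0`, given the parity floor
`2 ∣ deg φ` (which the tree proves at `N = 4p` from `w_p f = −f`, and which here follows from `w_N f = −f` only via E-es-AL; we
take it as a hypothesis). -/
theorem four_dvd_modularDegree_of_evenRank_selmer_nontrivial
    (hL : EvenRankDegreeTwoModFourForcesSelmerTrivial)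
    (W : WeierstrassCurve ℚ) [W.IsElliptic] [W.IsGloballyMinimal] {N : ℕ} [NeZero N]
    (D : ModularParametrizationData W N) (p : ℕ) (hp : p.Prime) (hp3 : p % 4 = 3) (hN : N = 4 * p)
    (hc : W.conductorNorm ℤ = N) (hT : ¬ HasRationalTwoTorsion W) (hK : IsSquare (-(p : ℚ) * W.Δ))
    (hF : frickeInvolution N 2 D.f = -D.f) (h2 : 2 ∣ D.modularDegree)
    (hS : ¬ (W.mordellWeilRank = 0 ∧ ShaTwoTrivial W)) : 4 ∣ D.modularDegree := by
  have hpos : D.modularDegree ≠ 0 := (D.deg_pos).ne'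
  have hv1 : padicValNat 2 D.modularDegree ≠ 1 := fun h => hS (hL W D p hp hp3 hN hc hT hK hF h)
  have hv0 : 1 ≤ padicValNat 2 D.modularDegree := by
    have h2' : 2 ^ 1 ∣ D.modularDegree := by rwa [pow_one]
    exact (padicValNat_dvd_iff_le (p := 2) hpos).mp h2'
  have hv2 : 2 ≤ padicValNat 2 D.modularDegree := by omega
  have : 2 ^ 2 ∣ D.modularDegree := (padicValNat_dvd_iff_le (p := 2) hpos).mpr hv2
  simpa using this

end Summit.BirchSwinnertonDyer.Rank1Residual.ManinAdditive.AtkinLehnerDegree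



/-!
# es g36 (cell bsd-f2-manin, MEMO-es §57.12.8) — the RAMIFIED-KUMMER LAW in the last open cell of L♮'s residual class
# (`N = 4p`, `p ≡ 3 (mod 8)`, Kodaira IV, odd rank)

Habitat: `N = 4p`, `p ≡ 3 (mod 8)` prime, `E(ℚ)[2] = 0`, `ℚ(√Δ_E) = ℚ(√−p)`, Kodaira type IV at 2 (`v₂(Δ_min) = 4`), `w_N f = f`
(odd analytic rank), rank `E(ℚ) = 1`.  Here the 2-division cubic has exactly ONE root `e₁ ∈ ℚ₂` (`Δ ≡ −p·□ ≡ 5·□` is not a 2-adic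
square), and for the generator class `P ∈ E(ℚ) ∖ 2E(ℚ)` the first Cassels–Kummer component `x(P) − e₁ ∈ ℚ₂^×/ℚ₂^{×2}` is a 2-adic
UNIT class `u ∈ {1, 3, 5, 7}` (198/198).  DATA LAW (engine census19.py, Cremona `4p < 5·10⁵`):

  `v₂(deg φ) = 1  ⟺  u ∈ {3, 7}`  (i.e. `ℚ₂(√(x(P) − e₁))/ℚ₂` is RAMIFIED)  — **198 / 198** (`u ∈ {3,7}`: 117, all `v₂ = 1`;
  `u = 5`: 60 and `u = 1`: 21, all `v₂ ≥ 2`),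

closing the cell left open in MEMO-es §57.12.4 (117 : 60 + 21).  With §57.12.2–3 this gives ONE reading for the whole residual class
(conjecture U♮, MEMO-es §57.12.8): the torsion CM value `t ∈ E[2]` vanishes iff some non-zero 2-Selmer element of `E/ℚ` localises at 2
into the «unramified-Kummer» subgroup `U₂ = {0} ∪ {u : ℚ₂(e₁)(√(x(u) − e₁)) / ℚ₂(e₁) unramified}` of `E(ℚ₂)/2E(ℚ₂)`.
Typed as two rows (any datum / lattice-optimal datum), generator-free: `P` ranges over rational points NOT divisible by 2 in `E(ℚ)`
(rank 1, odd torsion ⟹ all such `P` have the same class in `E(ℚ)/2E(ℚ) ≅ ℤ/2`).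
PARTITION 0 · BSD is not proved by this; Manin's conjecture is not proved by this (degree laws, no Manin implication).
-/

namespace Summit.BirchSwinnertonDyer.Rank1Residual.ManinAdditive.AtkinLehnerDegree

open scoped MatrixGroups ModularForm
open CongruenceSubgroup WeierstrassCurve
open Literature.NumberTheory.EllipticCurves Literature.NumberTheory.EllipticCurves.ModularForms
open Summit.BirchSwinnertonDyer.Rank1Residual.ManinAdditive.ConwayCut

/-- `x − e₁` lies in a RAMIFIED unit square class of `ℚ₂`: `x − e = u·z²` with `u ∈ {3, 7}`, for the 2-adic 2-torsion abscissa `e`. -/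
def RamifiedKummerClassAtTwo (W : WeierstrassCurve ℚ) (x : ℚ) : Prop :=
  ∀ e : ℚ_[2], (Polynomial.map (Rat.castHom ℚ_[2]) W.twoTorsionPolynomial.toPoly).eval e = 0 →
    ∃ z : ℚ_[2], ((x : ℚ_[2]) - e = 3 * z ^ 2 ∨ (x : ℚ_[2]) - e = 7 * z ^ 2)

/-- **Row E-es-176a `OddRankIVRamifiedKummerOfDegreeTwoModFour`** (LAW, NEW; MEMO-es §57.12.8): in the habitat (`p ≡ 3 (mod 8)`,
Kodaira IV, odd analytic rank, rank 1), for ANY parametrisation datum at the conductor: `v₂(deg φ) = 1 ⟹` for every rational point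
`P = (x, y)` not divisible by 2 in `E(ℚ)`, `x − e₁ ∈ {3, 7}·ℚ₂^{×2}`.  Census 198 / 198 (the 117 curves with `v₂(deg φ) = 1` all have
`u ∈ {3, 7}`).  Why it might fail: a member with `deg φ ≡ 2 (mod 4)` whose generator has `x(P) − e₁ ≡ 1, 5 (mod 8)·□`; none `< 5·10⁵`.
[cite: Watkins2002, §4 (arXiv:math/0109101 p. 12: powers of 2 in deg φ vs rank; the 2-adic Kummer-class refinement is the cell's E-es-176, NOT in print)] -/
@[conjecture]
def OddRankIVRamifiedKummerOfDegreeTwoModFour : Prop :=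
  ∀ (W : WeierstrassCurve ℚ) [W.IsElliptic] [W.IsGloballyMinimal] {N : ℕ} [NeZero N]
    (D : ModularParametrizationData W N) (p : ℕ), p.Prime → p % 8 = 3 → N = 4 * p → W.conductorNorm ℤ = N →
    ¬ HasRationalTwoTorsion W → IsSquare (-(p : ℚ) * W.Δ) → padicValRat 2 W.Δ = 4 → frickeInvolution N 2 D.f = D.f →
    W.mordellWeilRank = 1 → padicValNat 2 D.modularDegree = 1 →
    ∀ (x y : ℚ) (h : W.toAffine.Nonsingular x y),
      (¬ ∃ Q : W.toAffine.Point, 2 • Q = WeierstrassCurve.Affine.Point.some (W' := W.toAffine) x y h) →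
      RamifiedKummerClassAtTwo W x

/-- **Row E-es-176b `OddRankIVDegreeTwoModFourOfRamifiedKummer`** (LAW, NEW; MEMO-es §57.12.8), the converse for LATTICE-OPTIMAL data
and `Ш[2] = 0` (inlined; = `ShaTwoTrivial W` of Sketch-es-g36d): a rational point `P = (x, y)` not divisible by 2 in `E(ℚ)` with `x − e₁ ∈ {3, 7}·ℚ₂^{×2}` forces `¬ 4 ∣ deg φ`.
Census 117 / 117 (and the 81 curves with `u ∈ {1, 5}` all have `4 ∣ deg φ`).  Why it might fail: a ramified-class member with `t = 0`
(all `w_p`-fixed CM points of discriminant `−4p` over the rational half-point); none `< 5·10⁵`.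
[cite: Watkins2002, §4 (arXiv:math/0109101 p. 12; this converse law is the cell's E-es-176b, NOT in print)] -/
@[conjecture]
def OddRankIVDegreeTwoModFourOfRamifiedKummer : Prop :=
  ∀ (W : WeierstrassCurve ℚ) [W.IsElliptic] [W.IsGloballyMinimal] {N : ℕ} [NeZero N]
    (D : ModularParametrizationData W N) (p : ℕ), p.Prime → p % 8 = 3 → N = 4 * p → W.conductorNorm ℤ = N →
    (∀ z ∈ D.L.lattice, ∃ w ∈ periodLattice D.f, z = D.c * w) →
    ¬ HasRationalTwoTorsion W → IsSquare (-(p : ℚ) * W.Δ) → padicValRat 2 W.Δ = 4 → frickeInvolution N 2 D.f = D.f →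
    W.mordellWeilRank = 1 → (∀ s ∈ W.sha, (2 : ℕ) • s = 0 → s = 0) →
    ∀ (x y : ℚ) (h : W.toAffine.Nonsingular x y),
      (¬ ∃ Q : W.toAffine.Point, 2 • Q = WeierstrassCurve.Affine.Point.some (W' := W.toAffine) x y h) →
      RamifiedKummerClassAtTwo W x → ¬ 2 ^ 2 ∣ D.modularDegree

end Summit.BirchSwinnertonDyer.Rank1Residual.ManinAdditive.AtkinLehnerDegree

/-!
# es g36 (cell bsd-f2-manin, MEMO-es §57.12.9) — the FORMAL-GROUP BIT LAW on the Kodaira-IV half of L♮'s residual class (rows E-es-177a/b)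

Habitat: `N = 4p`, `p ≡ 3 (mod 4)` prime (BOTH classes mod 8), `E(ℚ)[2] = 0`, `ℚ(√Δ_E) = ℚ(√−p)`, Kodaira type IV at 2
(`v₂(Δ_min) = 4`), `w_N f = f` (odd analytic rank), rank `E(ℚ) = 1` (and `Ш[2] = 0` for the converse row).
The bit: `b₂(P) ∈ E⁰(ℚ₂)/E¹(ℚ₂) = Ẽ_ns(𝔽₂) ≅ ℤ/2` (image of `c₂·P`; `E¹` = formal group = kernel of reduction); `b₂(P) = 0 ⟺
P ∈ E¹(ℚ₂) + 2E(ℚ₂)`.  DATA LAW (engine census22.py 026b5cb5f79b86fe → out-census22-500000.txt f7f55cc417311be7, exact rational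
arithmetic + reduction mod 2, no p-adic roots; Cremona `4p < 5·10⁵`):

  Kodaira IV, rank 1:  `v₂(deg φ) = 1  ⟺  b₂(P) = 1`  — **393 / 393**  (`p ≡ 3 (8)`: 117 : 81; `p ≡ 7 (8)`: 123 : 72; 0 violations),

unifying E-es-175 (`p ≡ 7 (8)`: there `E¹ + 2E = 2E(ℚ₂)`, so `b₂(P) = 1 ⟺ P ∉ 2E(ℚ₂)`, 195/195) and E-es-176 (`p ≡ 3 (8)`: the image of
`E¹(ℚ₂)` in `E(ℚ₂)/2E(ℚ₂)` is exactly the Kummer classes `x − e₁ ∈ {1,5}·ℚ₂^{×2}`, census21.py 198/198).  On the IV* half `b₂` does NOT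
govern (`b₂ = 1` on 127, `= 0` on 121 of the 248 rank-1 IV* curves, all with `4 ∣ deg φ` = E-es-171♯).
Typed generator-free («`P = (x,y) ∈ E(ℚ)` not divisible by 2») and reduction-free (`E¹(ℚ₂)` = points of 2-adic norm `‖x‖ > 1`, over
`W.map (Rat.castHom ℚ_[2])`).  PARTITION 0 · BSD is not proved by this; no Manin implication (degree laws).

TYPER (g21, T-es-69 addendum 3): APPENDED VERBATIM from HOME/es/g36/Sketch-es-g36f.lean sha16 988763b1cd24024d (75 l.; es: rc 0, BC7 2/2 CLEAN
Probe-es-g36g c231ee6128b56b24; MEMO-es §57.12.9; census22.py 026b5cb5f79b86fe → out-census22-500000.txt f7f55cc417311be7, 393/393) to the landed file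
(p750937; tree copy above untouched): def `InFormalGroupModDoublesAtTwo`, rows **E-es-177a `OddRankIVFormalBitOfDegreeTwoModFour`**, **E-es-177b
`OddRankIVDegreeTwoModFourOfFormalBit`** (es's `@[conjecture]` tags, nothing asserted).  Same imports, same namespace.  bears_on: stmt-…-22967 (C2).
-/

namespace Summit.BirchSwinnertonDyer.Rank1Residual.ManinAdditive.AtkinLehnerDegree

open scoped MatrixGroups ModularForm
open CongruenceSubgroup WeierstrassCurve
open Literature.NumberTheory.EllipticCurves Literature.NumberTheory.EllipticCurves.ModularForms
open Summit.BirchSwinnertonDyer.Rank1Residual.ManinAdditive.ConwayCut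

open Classical in
/-- The rational point `(x, y)` lies in `E¹(ℚ₂) + 2E(ℚ₂)`: for some `Q ∈ E(ℚ₂)`, `(x,y) − 2Q` is zero or has `‖x‖₂ > 1` (formal group).
(`∀ h₂` over the transported non-singularity witness, which exists; the body does not depend on it.  `open Classical` supplies the
`DecidableEq ℚ_[2]` the group law on `Affine.Point` needs.) -/
def InFormalGroupModDoublesAtTwo (W : WeierstrassCurve ℚ) (x y : ℚ) : Prop :=
  ∀ h₂ : (W.map (Rat.castHom ℚ_[2])).toAffine.Nonsingular (x : ℚ_[2]) (y : ℚ_[2]),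
    ∃ Q : (W.map (Rat.castHom ℚ_[2])).toAffine.Point,
      WeierstrassCurve.Affine.Point.some (W' := (W.map (Rat.castHom ℚ_[2])).toAffine) _ _ h₂ - 2 • Q = 0 ∨
      ∃ (x' y' : ℚ_[2]) (h' : (W.map (Rat.castHom ℚ_[2])).toAffine.Nonsingular x' y'),
        WeierstrassCurve.Affine.Point.some (W' := (W.map (Rat.castHom ℚ_[2])).toAffine) _ _ h₂ - 2 • Q =
          WeierstrassCurve.Affine.Point.some (W' := (W.map (Rat.castHom ℚ_[2])).toAffine) x' y' h' ∧ 1 < ‖x'‖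

/-- **Row E-es-177a `OddRankIVFormalBitOfDegreeTwoModFour`** (LAW, NEW; MEMO-es §57.12.9): Kodaira IV, `p ≡ 3 (mod 4)`, odd analytic
rank, rank 1, ANY parametrisation datum at the conductor: `v₂(deg φ) = 1 ⟹` every rational point not divisible by 2 in `E(ℚ)` lies OUTSIDE
`E¹(ℚ₂) + 2E(ℚ₂)` (`b₂(P) = 1`).  Census 240 / 240 (`v₂ = 1` members), 393 / 393 with the converse.  Why it might fail: a member with
`deg φ ≡ 2 (mod 4)` whose generator doubles into the formal group 2-adically; none `< 5·10⁵`.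
[cite: Watkins2002, §4 (arXiv:math/0109101 p. 12: 2-powers in deg φ vs rank; the formal-group-bit refinement is the cell's E-es-177, NOT in print)] -/
@[conjecture]
def OddRankIVFormalBitOfDegreeTwoModFour : Prop :=
  ∀ (W : WeierstrassCurve ℚ) [W.IsElliptic] [W.IsGloballyMinimal] {N : ℕ} [NeZero N]
    (D : ModularParametrizationData W N) (p : ℕ), p.Prime → p % 4 = 3 → N = 4 * p → W.conductorNorm ℤ = N →
    ¬ HasRationalTwoTorsion W → IsSquare (-(p : ℚ) * W.Δ) → padicValRat 2 W.Δ = 4 → frickeInvolution N 2 D.f = D.f →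
    W.mordellWeilRank = 1 → padicValNat 2 D.modularDegree = 1 →
    ∀ (x y : ℚ) (h : W.toAffine.Nonsingular x y),
      (¬ ∃ Q : W.toAffine.Point, 2 • Q = WeierstrassCurve.Affine.Point.some (W' := W.toAffine) x y h) →
      ¬ InFormalGroupModDoublesAtTwo W x y

/-- **Row E-es-177b `OddRankIVDegreeTwoModFourOfFormalBit`** (LAW, NEW; MEMO-es §57.12.9), the converse for LATTICE-OPTIMAL data and
`Ш[2] = 0` (inlined): a rational point not divisible by 2 in `E(ℚ)` and outside `E¹(ℚ₂) + 2E(ℚ₂)` forces `¬ 4 ∣ deg φ`.  Census 240 / 240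
(and the 153 curves with `b₂(P) = 0` all have `4 ∣ deg φ`).  Why it might fail: a `b₂ = 1` member with `t = 0`; none `< 5·10⁵`.  FALSE on the
IV* half (127 counterexamples, e.g. 172a1: `deg φ = 12`, `P ∈ E⁰ ∖ E¹`) — hence the `v₂(Δ) = 4` binder is load-bearing.
[cite: Watkins2002, §4 (arXiv:math/0109101 p. 12; this converse law is the cell's E-es-177b, NOT in print)] -/
@[conjecture]
def OddRankIVDegreeTwoModFourOfFormalBit : Prop :=
  ∀ (W : WeierstrassCurve ℚ) [W.IsElliptic] [W.IsGloballyMinimal] {N : ℕ} [NeZero N]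
    (D : ModularParametrizationData W N) (p : ℕ), p.Prime → p % 4 = 3 → N = 4 * p → W.conductorNorm ℤ = N →
    (∀ z ∈ D.L.lattice, ∃ w ∈ periodLattice D.f, z = D.c * w) →
    ¬ HasRationalTwoTorsion W → IsSquare (-(p : ℚ) * W.Δ) → padicValRat 2 W.Δ = 4 → frickeInvolution N 2 D.f = D.f →
    W.mordellWeilRank = 1 → (∀ s ∈ W.sha, (2 : ℕ) • s = 0 → s = 0) →
    ∀ (x y : ℚ) (h : W.toAffine.Nonsingular x y),
      (¬ ∃ Q : W.toAffine.Point, 2 • Q = WeierstrassCurve.Affine.Point.some (W' := W.toAffine) x y h) →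
      ¬ InFormalGroupModDoublesAtTwo W x y → ¬ 2 ^ 2 ∣ D.modularDegree

end Summit.BirchSwinnertonDyer.Rank1Residual.ManinAdditive.AtkinLehnerDegree

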